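import Summits.AtomisticToContinuum.Crystallization.Theses.ThreeConeCertificate
import Summits.AtomisticToContinuum.Crystallization.Theorems.ThreeConeCertificateDefs
import Summits.AtomisticToContinuum.Crystallization.Theorems.ThreeConeCertificateOnePercentCertificateReduction
import Summits.AtomisticToContinuum.Crystallization.Theorems.ThreeConeCertificateOnePercentCertificatePeriodicReduction
import Summits.AtomisticToContinuum.Crystallization.Theorems.OnePercentCertificate.Negative.StubLocal
import Summits.AtomisticToContinuum.Crystallization.Theorems.ThreeConeCertificateOnePercentCertificateBookingSum

/-!
# `OnePercentCertificate` (stmt-AtomisticToContinuum-11958) — line `SketchIdeator5`: skeleton v2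

Lead prover-line-stmt-AtomisticToContinuum-11958-a2-0 (2026-08-17).  Line `SketchIdeator5` = ideator 5's
round-2 package (cards `Cruxes/OnePercentCertificate/Ideas/five-ring-discharging.md` — the functional,
`two-shell-relaxed-star.md` — the short-range variant, `semialgebraic-cell-certificates.md` — the leaf format).
The ideator's own `Sketch.lean` lives in the unmounted evidence store; this skeleton is rebuilt from the cards.

THE CHAIN.  The crux reduces (tree) to the periodic local constant
`∀ P : PeriodicConfiguration 3, −cS ≤ e_gS(P)` (`OnePercentPeriodic.onePercentCertificate_of_periodicLocalConstant`,
p115021 ∘ p112372), for the explicit split `gS/US/fS/cS` of `ThreeConeCertificateDefs.lean` (`cS ≈ 0.657987`,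
hcp `−0.651259`, margin `1.03 %`).  The line proves the periodic local constant by LAGARIAS'S LOCAL-DENSITY
THEOREM IN ENERGY FORM: book the pair energies of one period to its sites (`A`), book solid-angle content to
sites (`B`, total `≤ #sites`), correct by an antisymmetric flow (`φ`, the five-ring discharging
`τ·sign(n₅(w) − n₅(v))` along 555-bonds) and average over first-shell windows (`M`, column-stochastic); if every
windowed corrected star is `≥ 0` then `−κ ≤ e(P)` (`stub_bookingSum`, pure algebra).  The line's content is the
WITNESS: the Regge booking of the canonical Delaunay complex (dihedral fractions into cells, equal split per
cell, non-cell pairs by length fraction) with `κ = cS`, `τ = 3/1000`, `W₁ = {v} ∪ shell₁(v)` — measured `≥ +0.0045`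
on the realizable motif catalogue and `≥ +0.0060` under symmetric breathing at hcp (RESULTS-ideator5.md), to be
decided by the card's kill test F1 (general adversary on the windowed functional) run by this lead.

Stubs: `stub_bookingSum` (worker; LANDED p152419), `stub_certifiedWindowedBooking` (lead; the line's C⁺ at the
periodic level — existential over the booking data, strength = the periodic local constant; intended witness as
above, whose Lean typing needs the Delaunay complex of a periodic point set with solid-angle content, not in tree).
Composition: `OnePercentCertificate_of` concludes the crux BY NAME.
-/

noncomputable section

open scoped BigOperators
open Literature.MathematicalPhysics.StatisticalMechanics
open Summit.AtomisticToContinuum.Crystallization.Theorems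
open Summit.AtomisticToContinuum.Crystallization.Theorems.ThreeConeSplit

namespace Summit.AtomisticToContinuum.Crystallization.Theorems.FiveRingBooking

/-! ## Stub 1 — the booking sum: LANDED (p152419, `ThreeConeCertificateOnePercentCertificateBookingSum.lean`)

`stub_bookingSum` (Lagarias's local-density theorem, energy form, with flows and windows) is the tree theorem
`FiveRingBooking.stub_bookingSum` of the imported module (worker, wave 1). -/

/-! ## Stub 2 — the line's C⁺: a certified windowed booking of `gS` at `κ = cS` on every periodic configuration -/

/-- STUB (lead; the line's content `FiveRingWindowBound` at the periodic level).  For every periodic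
configuration `P` of `ℝ³`, the sites of one period (`P.motif`) carry booking data — booked `gS`-energy `A`
with `∑ A = #motif · e_gS(P)`, content `B` with `∑ B ≤ #motif`, an antisymmetric flow `φ`, column-stochastic
window weights `M ≥ 0` — whose windowed corrected stars `∑_b M a b (A b + cS·B b + ∑_c φ b c)` are all `≥ 0`.
INTENDED WITNESS (card five-ring-discharging): `A` = Regge booking of the pair energies `gS(|v − w|)`, `|v−w| < 5/2`,
into the cells of the canonical Delaunay complex of `P.points` (dihedral fraction per cell for complex edges,
length fraction for other pairs; equal split over the cell's vertices; summed per lattice orbit), `B v` =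
`∑_{C ∋ v} ω(C)/|C|` with `ω(C)` = (sum of the solid angles of `C`)/(4π), `φ v w = (3/1000)·sign(n₅ w − n₅ v)` on
five-ring (555) bonds and `0` otherwise, `M a b = [b ∈ W₁(a)]/|W₁(a)|`-type first-shell window weights normalised to
unit column sums.  Strength of the stub as typed: equivalent to the periodic local constant (take `A ≡ e`,
`B ≡ 1`, `φ = 0`, `M = id`); the line's bet is the witness, decided numerically (kill test F1). [folklore] -/
theorem stub_certifiedWindowedBooking :
    ∀ P : PeriodicConfiguration 3,
      ∃ (A B : ↥P.motif → ℝ) (φ M : ↥P.motif → ↥P.motif → ℝ),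
        (∀ a b, φ a b = -φ b a) ∧ ∑ a, A a = (P.motif.card : ℝ) * P.energyPerParticle gS ∧
        ∑ a, B a ≤ (P.motif.card : ℝ) ∧ (∀ a b, 0 ≤ M a b) ∧ (∀ b, ∑ a, M a b = 1) ∧
        ∀ a, 0 ≤ ∑ b, M a b * (A b + cS * B b + ∑ c, φ b c) := by
  sorry

/-! ## Composition -/

/-- `0 ≤ cS` (`cS = 657987/10⁶`). [folklore] -/
theorem cS_nonneg : 0 ≤ cS := by
  rw [StubLocal.cS_eq]; norm_num

/-- **Glue.** A certified windowed booking of one period gives the periodic local constant for that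
configuration: `stub_bookingSum` with `E = #motif · e_gS(P)`, `n = #motif`, then divide by `#motif > 0`. -/
theorem periodicLocalConstant_of_booking (P : PeriodicConfiguration 3)
    (h : ∃ (A B : ↥P.motif → ℝ) (φ M : ↥P.motif → ↥P.motif → ℝ),
        (∀ a b, φ a b = -φ b a) ∧ ∑ a, A a = (P.motif.card : ℝ) * P.energyPerParticle gS ∧
        ∑ a, B a ≤ (P.motif.card : ℝ) ∧ (∀ a b, 0 ≤ M a b) ∧ (∀ b, ∑ a, M a b = 1) ∧
        ∀ a, 0 ≤ ∑ b, M a b * (A b + cS * B b + ∑ c, φ b c)) :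
    -cS ≤ P.energyPerParticle gS := by
  obtain ⟨A, B, φ, M, hφ, hA, hB, hM, hM1, hpos⟩ := h
  have key := stub_bookingSum ((P.motif.card : ℝ) * P.energyPerParticle gS) cS (P.motif.card : ℝ)
    A B φ M cS_nonneg hφ hA hB hM hM1 hpos
  have hcard : (0 : ℝ) < (P.motif.card : ℝ) := by
    exact_mod_cast Finset.card_pos.mpr P.motif_nonempty
  -- `-(cS * #F) ≤ #F * e` ⇒ `-cS ≤ e`
  by_contra hlt
  push Not at hlt
  have : (P.motif.card : ℝ) * P.energyPerParticle gS < (P.motif.card : ℝ) * (-cS) :=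
    mul_lt_mul_of_pos_left hlt hcard
  linarith

/-- **The periodic local constant** from the two stubs. -/
theorem periodicLocalConstant : ∀ P : PeriodicConfiguration 3, -cS ≤ P.energyPerParticle gS :=
  fun P => periodicLocalConstant_of_booking P (stub_certifiedWindowedBooking P)

/-- **Composition.** The stubs give the crux `OnePercentCertificate` by name: the periodic local constant
(`periodicLocalConstant`) feeds the tree reduction `onePercentCertificate_of_periodicLocalConstant`
(periodisation p115021, then decomposition / slack sign / range / positive type / value of the split
`(cS, gS, US, fS)`, p112372). -/
theorem OnePercentCertificate_of :
    Summit.AtomisticToContinuum.Crystallization.Theses.ThreeConeCertificate.OnePercentCertificate :=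
  OnePercentPeriodic.onePercentCertificate_of_periodicLocalConstant periodicLocalConstant

end Summit.AtomisticToContinuum.Crystallization.Theorems.FiveRingBooking
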